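import Summits.RiemannHypothesis.RiemannHypothesis.Theorems.WeilGroundStateGroundStatesConvergeToXiEulerLagrange
import Summits.RiemannHypothesis.RiemannHypothesis.Theorems.WeilGroundStateGroundStatesConvergeToXiZeroSideOffLine
import Summits.RiemannHypothesis.RiemannHypothesis.Theorems.WeilGroundStateGroundStatesConvergeToXiWeightedL1
import Summits.RiemannHypothesis.RiemannHypothesis.Theorems.WeilGroundStateGroundStatesConvergeToXiEnergyUpper
import Literature.NumberTheory.LFunctions.WeilExplicit
import Literature.NumberTheory.LFunctions.WeilExplicitProofs
import Literature.NumberTheory.LFunctions.WeilExplicitFormulaProofs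
import Literature.NumberTheory.LFunctions.WeilMellinBounds
import Literature.NumberTheory.LFunctions.WeilZeroSum
import Literature.NumberTheory.LFunctions.WeilCriterionConverse
import Literature.NumberTheory.LFunctions.WeilGroundState
import Literature.NumberTheory.LFunctions.WeilGroundStateRealZerosProofs
import Literature.NumberTheory.LFunctions.SoundZeroSideSums
import Mathlib.Analysis.Normed.Group.Tannery
import HarnessLib

/-!
# RiemannHypothesis / WeilGroundState — the zero-side Euler–Lagrange equation of a Weil ground
state, and (under RH) the sampling inequality at the zeta zeros

Route `RiemannHypothesis/WeilGroundState`, crux item stmt-RiemannHypothesis-1527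
(`GroundStatesConvergeToXi`), line `Sketch`, continuation lead c4 (helper file, `--supports`).

The tree PROVES the Guinand–Weil explicit formula (`explicit_formula_holds`).  Transporting the
weak Euler–Lagrange equation of an operator-free ground state `u` at the window `a`
(`IsWeilGroundState.exists_eulerLagrange`: `W(gₙ ⋆ h̃) → ε(a) ∫ u h̄` along the minimising
sequence, every window test `h`) to the ZERO SIDE gives:

* `norm_weilMellin_le_decay4` — fourth-order decay of the transform of a test function in the
  closed strip, `‖ĝ(s)‖ ≤ (C_g + C_{g''})/(1 + (Im s)²)²` (two more integrations by parts).
* `hasSum_zeroSide_weilConv_weilReflect` — for test functions `g, h`: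
  `Σ_ρ m(ρ) ĝ(ρ) conj ĥ(1 - ρ̄) = W(g ⋆ h̃)` (absolutely convergent; explicit formula for the
  test function `g ⋆ h̃`, `(g ⋆ h̃)^ = ĝ · conj ĥ(1 - conj ·)`).
* `hasSum_zeroSide_eulerLagrange` — **zero-side Euler–Lagrange equation (RH-free)**: for every
  ground state `u` at the window `a` and every test function `h` supported in `[-a, a]`,
  `Σ_ρ m(ρ) û(ρ) conj ĥ(1 - ρ̄) = ε(a) ∫ u h̄`, the series converging absolutely (Tannery:
  `ĝₙ(ρ) → û(ρ)` termwise, dominated by `sup weilL1(gₙ) · (C_h + C_{h''}) m(ρ)/(1+γ²)²`).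
  In operator language: `T_a^* T_a u = ε(a) u` weakly, `T_a u = (û(ρ))_ρ` the sampling map at
  the zeros.
* `hasSum_zeroSide_eulerLagrange_of_riemannHypothesis` — under RH the same identity with
  `ĥ(ρ)` in place of `ĥ(1 - ρ̄)`.
* `sum_re_order_mul_pairCoeff_le`, `sum_re_order_mul_pairCoeff_le_weilGroundEnergy` —
  **(RH-free)** for every finite set `S` of non-trivial zeros containing the off-line ones,
  `Σ_{ρ ∈ S} Re(m(ρ) P_g(ρ)) ≤ Re Q(g)` for test functions and `Σ_{ρ ∈ S} Re(m(ρ) P_u(ρ)) ≤ ε(a)`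
  for ground states (`P_f(ρ) = f̂(ρ) conj f̂(1 - ρ̄)`; on-line terms are `m(ρ)|f̂(ρ)|² ≥ 0`).
* `summable_order_mul_norm_sq_weilMellin_of_riemannHypothesis` — **under RH, the sampling
  inequality** `Σ_ρ m(ρ) |û(ρ)|² ≤ ε(a)` for every ground state (all finite partial sums, hence
  the series); consequently (`norm_sq_weilMellin_le_weilGroundEnergy_of_riemannHypothesis`)
  `|û(ρ)|² ≤ ε(a)` at every non-trivial zero, and, by the RH-free super-exponential energy
  bound `weilGroundEnergy_le_superexp`,
  `exists_norm_sq_weilMellin_le_superexp_of_riemannHypothesis`: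
  `|û(ρ)|² ≤ C exp(-(π/2) e^{2(a-1)})` for `a ≥ 2` — **every ground state's transform nearly
  vanishes at every zeta zero, super-exponentially in the window**, the formal content of the
  "node locking" seen in the crux numerics (`Numerics-r1-k2.md`: the zeros of `û_a` on the
  critical line agree with the zeta ordinates to `1e-18` at `a = 1.24`).

Bearing on the crux: multiplying the Euler–Lagrange identity by the crux constants `c_k` shows
what "crux ⇒ RH verbatim" would need in the one regime left open by c3/Theorem D (infinitely
many off-line zeros, `‖c_k‖ → ∞`, `û_k → 0` on compacta): control of the HIGH zeros
`Σ_{|γ| > T} m(ρ) c_k û_k(ρ) conj ĥ(1 - ρ̄)`, which locally uniform convergence on the strip does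
not give (`|û_k(ρ)| ≤ √(2a_k) e^{a_k/2}` only) — recorded as the line's dead end, not attempted.

Mathlib + proved tree material only; no named fact; no definitions; standard axioms.
-/

set_option linter.dupNamespace false

noncomputable section

open MeasureTheory Complex Filter Set
open scoped Real Topology ComplexConjugate

namespace Summit.RiemannHypothesis.RiemannHypothesis.Theorems.GroundStatesConvergeToXi

open Literature.NumberTheory.LFunctions

/-! ### Fourth-order decay of test-function transforms in the closed strip -/

/-- **Fourth-order decay**: for a test function `g` and `0 ≤ Re s ≤ 1`,
`‖ĝ(s)‖ ≤ (C_g + C_{g''}) / (1 + (Im s)²)²`, where `C_f = weilDecayConst f`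
(`norm_weilMellin_le` for `g` and for `g''`, and `(g'')^(s) = (s - 1/2)² ĝ(s)`). [folklore] -/
theorem norm_weilMellin_le_decay4 {g : ℝ → ℂ} (hg : IsWeilTest g) {s : ℂ} (hs0 : 0 ≤ s.re)
    (hs1 : s.re ≤ 1) :
    ‖weilMellin g s‖ ≤
      (weilDecayConst g + weilDecayConst (deriv (deriv g))) / (1 + s.im ^ 2) ^ 2 := by
  have hpos : 0 < 1 + s.im ^ 2 := by positivity
  have h1 := norm_weilMellin_le hg hs0 hs1
  have h2 := norm_weilMellin_le hg.deriv.deriv hs0 hs1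
  rw [weilMellin_deriv_deriv hg, norm_mul, norm_pow] at h2
  rw [le_div_iff₀ hpos] at h1 h2
  have h3 : s.im ^ 2 ≤ ‖s - 1 / 2‖ ^ 2 := by
    have : |s.im| ≤ ‖s - 1 / 2‖ := by
      have h := Complex.abs_im_le_norm (s - 1 / 2)
      simpa using h
    nlinarith [abs_nonneg s.im, sq_abs s.im]
  rw [le_div_iff₀ (by positivity)]
  have h4 : 0 ≤ ‖weilMellin g s‖ := norm_nonneg _
  have h5 : 0 ≤ ‖weilMellin g s‖ * (1 + s.im ^ 2) := by positivity
  nlinarith [mul_le_mul_of_nonneg_right h3 h5]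

/-- The reflected point `1 - ρ̄` of a non-trivial zero lies in the closed strip and has the same
ordinate. [folklore] -/
theorem one_sub_conj_mem_strip {ρ : ℂ} (hρ : ρ ∈ ZetaZeros.riemannZetaNontrivialZeros) :
    0 ≤ (1 - conj ρ).re ∧ (1 - conj ρ).re ≤ 1 ∧ (1 - conj ρ).im = ρ.im := by
  have h0 := ZetaZeros.riemannZetaNontrivialZeros.re_pos hρ
  have h1 := ZetaZeros.riemannZetaNontrivialZeros.re_lt_one hρ
  refine ⟨?_, ?_, ?_⟩
  · simp only [sub_re, one_re, conj_re]; linarith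
  · simp only [sub_re, one_re, conj_re]; linarith
  · simp only [sub_im, one_im, conj_im]; ring

/-- Decay of the reflected factor at the zeros: for a test function `h` and a non-trivial zero
`ρ`, `‖ĥ(1 - ρ̄)‖ ≤ (C_h + C_{h''})/(1 + γ²)²`. [folklore] -/
theorem norm_weilMellin_one_sub_conj_le {h : ℝ → ℂ} (hh : IsWeilTest h) {ρ : ℂ}
    (hρ : ρ ∈ ZetaZeros.riemannZetaNontrivialZeros) :
    ‖weilMellin h (1 - conj ρ)‖ ≤
      (weilDecayConst h + weilDecayConst (deriv (deriv h))) / (1 + ρ.im ^ 2) ^ 2 := by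
  obtain ⟨h0, h1, him⟩ := one_sub_conj_mem_strip hρ
  have := norm_weilMellin_le_decay4 hh h0 h1
  rwa [him] at this

/-! ### The zero side of `g ⋆ h̃` for test functions -/

/-- **Zero side of a polarised convolution.**  For test functions `g, h`:
`Σ_ρ m(ρ) ĝ(ρ) conj ĥ(1 - ρ̄) = W(g ⋆ h̃)`, the sum over the non-trivial zeros converging
absolutely (explicit formula `explicit_formula_holds` at the test function `g ⋆ h̃`;
`(g ⋆ h̃)^(ρ) = ĝ(ρ) · (h̃)^(ρ) = ĝ(ρ) conj ĥ(1 - ρ̄)`; the symmetric truncations of an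
absolutely convergent zero side converge to its sum, `hasWeilZeroSide_tsum`). [folklore] -/
theorem hasSum_zeroSide_weilConv_weilReflect {g h : ℝ → ℂ} (hg : IsWeilTest g)
    (hh : IsWeilTest h) :
    HasSum (fun ρ : ZetaZeros.riemannZetaNontrivialZeros ↦ (riemannZetaZeroOrder (ρ : ℂ) : ℂ) *
        (weilMellin g ρ * conj (weilMellin h (1 - conj (ρ : ℂ)))))
      (weilFunctional (weilConv g (weilReflect h))) := by
  have hf : IsWeilTest (weilConv g (weilReflect h)) := hg.weilConv hh.weilReflect
  have hterm : ∀ ρ : ℂ, weilMellin (weilConv g (weilReflect h)) ρ =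
      weilMellin g ρ * conj (weilMellin h (1 - conj ρ)) := by
    intro ρ
    rw [weilMellin_weilConv_holds hg.1.continuous hg.2 hh.weilReflect.1.continuous
      hh.weilReflect.2 ρ, weilMellin_weilReflect_holds h ρ]
  -- absolute summability of the zero side of `g ⋆ h̃`
  set K : ℝ := weilL1 g * (weilDecayConst h + weilDecayConst (deriv (deriv h))) with hK
  have hbound : ∀ ρ ∈ ZetaZeros.riemannZetaNontrivialZeros,
      ‖weilMellin (weilConv g (weilReflect h)) ρ‖ ≤ K / (1 + ρ.im ^ 2) ^ 2 := by
    intro ρ hρ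
    rw [hterm ρ, norm_mul, Complex.norm_conj, hK, mul_div_assoc]
    exact mul_le_mul
      (norm_weilMellin_le_weilL1 hg.1.continuous hg.2
        (ZetaZeros.riemannZetaNontrivialZeros.re_pos hρ).le
        (ZetaZeros.riemannZetaNontrivialZeros.re_lt_one hρ).le)
      (norm_weilMellin_one_sub_conj_le hh hρ) (norm_nonneg _) (weilL1_nonneg g)
  have hsumm := summable_norm_zeroSide_of_le hbound
  have hZ := hasWeilZeroSide_tsum hsumm
  have hEF := explicit_formula_holds hf
  have heq := tendsto_nhds_unique hZ hEF
  have hHS := hsumm.of_norm.hasSum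
  rw [heq] at hHS
  refine hHS.congr_fun fun ρ ↦ ?_
  rw [hterm]

/-! ### The zero-side Euler–Lagrange equation -/

/-- **Zero-side Euler–Lagrange equation of a Weil ground state (RH-free).**  Let `u` be a ground
state at the window `a` (`IsWeilGroundState a u`) and `h` a test function supported in
`[-a, a]`.  Then
`Σ_ρ m(ρ) û(ρ) conj ĥ(1 - ρ̄) = ε(a) ∫ u h̄`,
the sum over the non-trivial zeros of `ζ` converging absolutely.  Proof: along the minimising
sequence `gₙ → u` of `u`, `Σ_ρ m(ρ) ĝₙ(ρ) conj ĥ(1 - ρ̄) = W(gₙ ⋆ h̃)`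
(`hasSum_zeroSide_weilConv_weilReflect`) tends to `ε(a) ∫ u h̄` (weak Euler–Lagrange equation,
`IsWeilGroundState.exists_eulerLagrange`), and to `Σ_ρ m(ρ) û(ρ) conj ĥ(1 - ρ̄)` by Tannery's
theorem: termwise `ĝₙ(ρ) → û(ρ)` (`ConnesVanSuijlekom.tendsto_weilMellin`), dominated by
`sup weilL1(gₙ) · (C_h + C_{h''}) · m(ρ)/(1 + γ²)²` (`weilZeroSummable`). [folklore] -/
theorem hasSum_zeroSide_eulerLagrange {a : ℝ} {u : ℝ → ℂ} (hu : IsWeilGroundState a u)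
    {h : ℝ → ℂ} (hh : IsWeilTest h) (hhs : tsupport h ⊆ Icc (-a) a) :
    HasSum (fun ρ : ZetaZeros.riemannZetaNontrivialZeros ↦ (riemannZetaZeroOrder (ρ : ℂ) : ℂ) *
        (weilMellin u ρ * conj (weilMellin h (1 - conj (ρ : ℂ)))))
      ((weilGroundEnergy a : ℂ) * ∫ t, u t * conj (h t)) := by
  obtain ⟨g, hg, hQ, hL, hEL⟩ := hu.exists_eulerLagrange
  have hW := hEL h hh hhs
  set C : ℝ := weilDecayConst h + weilDecayConst (deriv (deriv h)) with hC
  have hC0 : 0 ≤ C := add_nonneg (weilDecayConst_nonneg _) (weilDecayConst_nonneg _)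
  -- the terms
  set T : ℕ → ZetaZeros.riemannZetaNontrivialZeros → ℂ := fun n ρ ↦
    (riemannZetaZeroOrder (ρ : ℂ) : ℂ) * (weilMellin (g n) ρ * conj (weilMellin h (1 - conj (ρ : ℂ))))
    with hT
  set Tu : ZetaZeros.riemannZetaNontrivialZeros → ℂ := fun ρ ↦
    (riemannZetaZeroOrder (ρ : ℂ) : ℂ) * (weilMellin u ρ * conj (weilMellin h (1 - conj (ρ : ℂ))))
    with hTu
  -- `Σ T n = W(gₙ ⋆ h̃)`
  have hsumn : ∀ n, HasSum (T n) (weilFunctional (weilConv (g n) (weilReflect h))) := fun n ↦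
    hasSum_zeroSide_weilConv_weilReflect (hg n).1 hh
  -- a uniform bound on `weilL1 (g n)` (eventually)
  have hL1 : Tendsto (fun n ↦ weilL1 (g n)) atTop (𝓝 (∫ t, ‖u t‖ * Real.exp (1 / 2 * |t|))) := by
    have h1 := tendsto_integral_norm_mul_exp_of_minimizingSeq hu hg hL (1 / 2)
    refine h1.congr fun n ↦ ?_
    rw [weilL1_eq_integral_half]
  set L : ℝ := ∫ t, ‖u t‖ * Real.exp (1 / 2 * |t|) with hLdef
  have hev : ∀ᶠ n in atTop, weilL1 (g n) ≤ L + 1 :=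
    hL1.eventually (eventually_le_nhds (by linarith))
  -- the dominating sequence
  set bound : ZetaZeros.riemannZetaNontrivialZeros → ℝ := fun ρ ↦
    (L + 1) * C * weilZeroWeight (ρ : ℂ) with hbound
  have hbound_summ : Summable bound := weilZeroSummable.mul_left _
  have hdom : ∀ᶠ n in atTop, ∀ ρ, ‖T n ρ‖ ≤ bound ρ := by
    filter_upwards [hev] with n hn ρ
    have hm : (0 : ℝ) ≤ riemannZetaZeroOrder (ρ : ℂ) := by
      exact_mod_cast riemannZetaZeroOrder_nonneg (ZetaZeros.riemannZetaNontrivialZeros.ne_one ρ.2)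
    have hg1 : ‖weilMellin (g n) ρ‖ ≤ L + 1 :=
      (norm_weilMellin_le_weilL1 (hg n).1.1.continuous (hg n).1.2
        (ZetaZeros.riemannZetaNontrivialZeros.re_pos ρ.2).le
        (ZetaZeros.riemannZetaNontrivialZeros.re_lt_one ρ.2).le).trans hn
    have hh1 := norm_weilMellin_one_sub_conj_le hh ρ.2
    have hL0 : 0 ≤ L + 1 := (weilL1_nonneg (g n)).trans hn
    simp only [hT, hbound, norm_mul, Complex.norm_intCast, Complex.norm_conj, weilZeroWeight]
    rw [abs_of_nonneg hm]
    calc (riemannZetaZeroOrder (ρ : ℂ) : ℝ) * (‖weilMellin (g n) ρ‖ * ‖weilMellin h (1 - conj (ρ : ℂ))‖)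
        ≤ (riemannZetaZeroOrder (ρ : ℂ) : ℝ) * ((L + 1) * (C / (1 + (ρ : ℂ).im ^ 2) ^ 2)) :=
          mul_le_mul_of_nonneg_left (mul_le_mul hg1 hh1 (norm_nonneg _) hL0) hm
      _ = (L + 1) * C * ((riemannZetaZeroOrder (ρ : ℂ) : ℝ) / (1 + (ρ : ℂ).im ^ 2) ^ 2) := by ring
  -- termwise convergence
  have hterm : ∀ ρ : ZetaZeros.riemannZetaNontrivialZeros, Tendsto (fun n ↦ T n ρ) atTop (𝓝 (Tu ρ)) := by
    intro ρ
    have h1 := ConnesVanSuijlekom.tendsto_weilMellin hu (fun n ↦ ⟨(hg n).1, (hg n).2.1⟩) hL (ρ : ℂ)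
    exact ((h1.mul_const _).const_mul _)
  -- Tannery
  have hTann := tendsto_tsum_of_dominated_convergence hbound_summ hterm hdom
  have hlim1 : Tendsto (fun n ↦ ∑' ρ, T n ρ) atTop (𝓝 ((weilGroundEnergy a : ℂ) * ∫ t, u t * conj (h t))) := by
    refine hW.congr fun n ↦ ?_
    exact ((hsumn n).tsum_eq).symm
  have heq : ∑' ρ, Tu ρ = (weilGroundEnergy a : ℂ) * ∫ t, u t * conj (h t) :=
    tendsto_nhds_unique hTann hlim1
  -- summability of the limit terms: `‖Tu ρ‖ ≤ bound ρ`
  have hTu_le : ∀ ρ, ‖Tu ρ‖ ≤ bound ρ := fun ρ ↦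
    le_of_tendsto (hterm ρ).norm (hdom.mono fun n hn ↦ hn ρ)
  have hsTu : Summable Tu := Summable.of_norm_bounded hbound_summ hTu_le
  rw [← heq]
  exact hsTu.hasSum

/-- Under RH the reflection `ρ ↦ 1 - ρ̄` fixes every non-trivial zero
(`SoundTest.re_eq_half_of_RH`: every non-trivial zero has real part `1/2`). [folklore] -/
theorem one_sub_conj_eq_of_riemannHypothesis (hRH : RiemannHypothesis)
    (ρ : ZetaZeros.riemannZetaNontrivialZeros) : 1 - conj (ρ : ℂ) = ρ := by
  apply Complex.ext
  · simp only [sub_re, one_re, conj_re, SoundTest.re_eq_half_of_RH hRH ρ]; norm_num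
  · simp only [sub_im, one_im, conj_im]; ring

/-- **Zero-side Euler–Lagrange equation under RH**: for a ground state `u` at the window `a` and
a test function `h` supported in `[-a, a]`, `Σ_ρ m(ρ) û(ρ) conj ĥ(ρ) = ε(a) ∫ u h̄` — under RH the
reflection `ρ ↦ 1 - ρ̄` is the identity on the zeros, so the sampling map `T : f ↦ (ĝ(ρ))_ρ`
satisfies `⟨T u, T h⟩ = ε(a) ⟨u, h⟩`, i.e. `T*T u = ε(a) u` weakly. [folklore] -/
theorem hasSum_zeroSide_eulerLagrange_of_riemannHypothesis (hRH : RiemannHypothesis) {a : ℝ}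
    {u : ℝ → ℂ} (hu : IsWeilGroundState a u) {h : ℝ → ℂ} (hh : IsWeilTest h)
    (hhs : tsupport h ⊆ Icc (-a) a) :
    HasSum (fun ρ : ZetaZeros.riemannZetaNontrivialZeros ↦ (riemannZetaZeroOrder (ρ : ℂ) : ℂ) *
        (weilMellin u ρ * conj (weilMellin h ρ)))
      ((weilGroundEnergy a : ℂ) * ∫ t, u t * conj (h t)) := by
  refine (hasSum_zeroSide_eulerLagrange hu hh hhs).congr_fun fun ρ ↦ ?_
  rw [one_sub_conj_eq_of_riemannHypothesis hRH ρ]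

/-! ### The sampling inequality at the zeros -/

/-- **Finite zero-side sums are bounded by the form (RH-free).**  For a test function `g` and a
finite set `S` of non-trivial zeros containing every zero off the critical line,
`Σ_{ρ ∈ S} Re(m(ρ) P_g(ρ)) ≤ Re Q(g)`, `P_g(ρ) = ĝ(ρ) conj ĝ(1 - ρ̄)`: the zero side
`Q(g) = Σ_ρ m(ρ) P_g(ρ)` converges absolutely (`WeilConverse.summable_pairCoeff`,
`explicit_formula_holds`) and every term outside `S` is an on-line term `m(ρ)|ĝ(ρ)|² ≥ 0`. [folklore] -/
theorem sum_re_order_mul_pairCoeff_le {g : ℝ → ℂ} (hg : IsWeilTest g)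
    (S : Finset ZetaZeros.riemannZetaNontrivialZeros)
    (hS : ∀ ρ : ZetaZeros.riemannZetaNontrivialZeros, (ρ : ℂ).re ≠ 1 / 2 → ρ ∈ S) :
    ∑ ρ ∈ S, ((riemannZetaZeroOrder (ρ : ℂ) : ℂ) * WeilConverse.pairCoeff g ρ).re ≤
      (weilQuadratic g).re := by
  classical
  have hQ : WeilConverse.zeroForm g = weilQuadratic g :=
    tendsto_nhds_unique (WeilConverse.hasWeilZeroSide_zeroForm hg)
      (explicit_formula_holds (hg.weilConv hg.weilReflect))
  set f : ZetaZeros.riemannZetaNontrivialZeros → ℂ :=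
    fun ρ ↦ (riemannZetaZeroOrder (ρ : ℂ) : ℂ) * WeilConverse.pairCoeff g ρ with hf
  have hsum : Summable f := WeilConverse.summable_pairCoeff hg
  have hre : (weilQuadratic g).re = ∑' ρ, (f ρ).re := by
    rw [← hQ, WeilConverse.zeroForm, Complex.re_tsum hsum]
  have hsumre : Summable fun ρ ↦ (f ρ).re := (Complex.hasSum_re hsum.hasSum).summable
  have hsplit := hsumre.sum_add_tsum_compl (s := S)
  have hcompl : 0 ≤ ∑' ρ : ↥((S : Set ZetaZeros.riemannZetaNontrivialZeros)ᶜ), (f ρ).re := by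
    refine tsum_nonneg fun ρ ↦ ?_
    have hρS : (ρ : ZetaZeros.riemannZetaNontrivialZeros) ∉ S := fun h ↦ ρ.2 (Finset.mem_coe.2 h)
    have hline : ((ρ : ZetaZeros.riemannZetaNontrivialZeros) : ℂ).re = 1 / 2 := by
      by_contra h
      exact hρS (hS _ h)
    exact re_order_mul_pairCoeff_nonneg_of_re_eq_half g
      (ρ : ZetaZeros.riemannZetaNontrivialZeros).2 hline
  rw [hre, ← hsplit]
  linarith

/-- **Finite zero-side sums of a ground state are bounded by its energy (RH-free).**  For a
ground state `u` at the window `a` and a finite set `S` of non-trivial zeros containing every zero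
off the critical line, `Σ_{ρ ∈ S} Re(m(ρ) û(ρ) conj û(1 - ρ̄)) ≤ ε(a)` (the bound for the
minimising sequence, `sum_re_order_mul_pairCoeff_le`, passes to the limit termwise on the finite
set, `tendsto_pairCoeff`). [folklore] -/
theorem sum_re_order_mul_pairCoeff_le_weilGroundEnergy {a : ℝ} {u : ℝ → ℂ}
    (hu : IsWeilGroundState a u) (S : Finset ZetaZeros.riemannZetaNontrivialZeros)
    (hS : ∀ ρ : ZetaZeros.riemannZetaNontrivialZeros, (ρ : ℂ).re ≠ 1 / 2 → ρ ∈ S) :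
    ∑ ρ ∈ S, ((riemannZetaZeroOrder (ρ : ℂ) : ℂ) * WeilConverse.pairCoeff u ρ).re ≤
      weilGroundEnergy a := by
  obtain ⟨_, g, hg, hQ, hL⟩ := id hu
  have hT : Tendsto (fun n ↦ ∑ ρ ∈ S,
      ((riemannZetaZeroOrder (ρ : ℂ) : ℂ) * WeilConverse.pairCoeff (g n) ρ).re) atTop
      (𝓝 (∑ ρ ∈ S, ((riemannZetaZeroOrder (ρ : ℂ) : ℂ) * WeilConverse.pairCoeff u ρ).re)) := by
    refine tendsto_finsetSum S fun ρ _ ↦ ?_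
    exact (Complex.continuous_re.tendsto _).comp
      ((tendsto_pairCoeff hu (fun n ↦ ⟨(hg n).1, (hg n).2.1⟩) hL ρ).const_mul _)
  exact le_of_tendsto_of_tendsto' hT hQ fun n ↦ sum_re_order_mul_pairCoeff_le (hg n).1 S hS

/-- On the critical line the zero-side term is `m(ρ)|ĝ(ρ)|²`:
`Re(m(ρ) P_g(ρ)) = m(ρ) ‖ĝ(ρ)‖²` for `Re ρ = 1/2`. [folklore] -/
theorem re_order_mul_pairCoeff_eq_of_re_eq_half (g : ℝ → ℂ) {ρ : ℂ} (hre : ρ.re = 1 / 2) :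
    ((riemannZetaZeroOrder ρ : ℂ) * WeilConverse.pairCoeff g ρ).re =
      (riemannZetaZeroOrder ρ : ℝ) * ‖weilMellin g ρ‖ ^ 2 := by
  have hrefl : 1 - conj ρ = ρ := by
    apply Complex.ext
    · simp only [sub_re, one_re, conj_re, hre]; norm_num
    · simp only [sub_im, one_im, conj_im]; ring
  rw [WeilConverse.pairCoeff, hrefl, Complex.mul_conj, ← Complex.ofReal_intCast,
    ← Complex.ofReal_mul, Complex.ofReal_re, Complex.normSq_eq_norm_sq]

/-- **The sampling inequality (under RH).**  For every ground state `u` at a window `a`, the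
series `Σ_ρ m(ρ) |û(ρ)|²` over the non-trivial zeros converges and its sum is at most the ground
energy `ε(a)`: under RH all zero-side terms are `m(ρ)|û(ρ)|² ≥ 0` and every finite partial sum
is `≤ ε(a)` (`sum_re_order_mul_pairCoeff_le_weilGroundEnergy` with `S` arbitrary).  With the
Euler–Lagrange equation (`hasSum_zeroSide_eulerLagrange_of_riemannHypothesis` at `h → u`) this is
`‖T u‖² ≤ ε(a) = inf ‖T g‖²/‖g‖²` for the sampling map `T` at the zeros. [folklore] -/
theorem summable_order_mul_norm_sq_weilMellin_of_riemannHypothesis (hRH : RiemannHypothesis)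
    {a : ℝ} {u : ℝ → ℂ} (hu : IsWeilGroundState a u) :
    Summable (fun ρ : ZetaZeros.riemannZetaNontrivialZeros ↦
        (riemannZetaZeroOrder (ρ : ℂ) : ℝ) * ‖weilMellin u ρ‖ ^ 2) ∧
      ∑' ρ : ZetaZeros.riemannZetaNontrivialZeros,
          (riemannZetaZeroOrder (ρ : ℂ) : ℝ) * ‖weilMellin u ρ‖ ^ 2 ≤ weilGroundEnergy a := by
  have hnn : 0 ≤ fun ρ : ZetaZeros.riemannZetaNontrivialZeros ↦
      (riemannZetaZeroOrder (ρ : ℂ) : ℝ) * ‖weilMellin u ρ‖ ^ 2 := by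
    intro ρ
    have hm : (0 : ℝ) ≤ riemannZetaZeroOrder (ρ : ℂ) := by
      exact_mod_cast riemannZetaZeroOrder_nonneg (ZetaZeros.riemannZetaNontrivialZeros.ne_one ρ.2)
    exact mul_nonneg hm (sq_nonneg _)
  have hle : ∀ S : Finset ZetaZeros.riemannZetaNontrivialZeros,
      ∑ ρ ∈ S, (riemannZetaZeroOrder (ρ : ℂ) : ℝ) * ‖weilMellin u ρ‖ ^ 2 ≤ weilGroundEnergy a := by
    intro S
    have h := sum_re_order_mul_pairCoeff_le_weilGroundEnergy hu S
      fun ρ hρ ↦ absurd (SoundTest.re_eq_half_of_RH hRH ρ) hρ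
    calc ∑ ρ ∈ S, (riemannZetaZeroOrder (ρ : ℂ) : ℝ) * ‖weilMellin u ρ‖ ^ 2
        = ∑ ρ ∈ S, ((riemannZetaZeroOrder (ρ : ℂ) : ℂ) * WeilConverse.pairCoeff u ρ).re :=
          Finset.sum_congr rfl fun ρ _ ↦
            (re_order_mul_pairCoeff_eq_of_re_eq_half u (SoundTest.re_eq_half_of_RH hRH ρ)).symm
      _ ≤ weilGroundEnergy a := h
  exact ⟨summable_of_sum_le hnn hle, Real.tsum_le_of_sum_le hnn hle⟩

/-- **Every ground state's transform is small at every zeta zero (under RH):**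
`‖û(ρ)‖² ≤ ε(a)` for every non-trivial zero `ρ` and every ground state `u` at the window `a`
(one term of the sampling inequality; `m(ρ) ≥ 1`). [folklore] -/
theorem norm_sq_weilMellin_le_weilGroundEnergy_of_riemannHypothesis (hRH : RiemannHypothesis)
    {a : ℝ} {u : ℝ → ℂ} (hu : IsWeilGroundState a u) {ρ : ℂ}
    (hρ : ρ ∈ ZetaZeros.riemannZetaNontrivialZeros) :
    ‖weilMellin u ρ‖ ^ 2 ≤ weilGroundEnergy a := by
  have h1 : (1 : ℝ) ≤ riemannZetaZeroOrder ρ := by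
    exact_mod_cast ZetaZeros.riemannZetaNontrivialZeros.one_le_order hρ
  have h := sum_re_order_mul_pairCoeff_le_weilGroundEnergy hu {⟨ρ, hρ⟩}
    fun ρ' hρ' ↦ absurd (SoundTest.re_eq_half_of_RH hRH ρ') hρ'
  rw [Finset.sum_singleton, re_order_mul_pairCoeff_eq_of_re_eq_half u
    (SoundTest.re_eq_half_of_RH hRH ⟨ρ, hρ⟩)] at h
  have h2 : ‖weilMellin u ρ‖ ^ 2 ≤ (riemannZetaZeroOrder ρ : ℝ) * ‖weilMellin u ρ‖ ^ 2 := by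
    nlinarith [sq_nonneg ‖weilMellin u ρ‖]
  exact h2.trans h

/-- **Node locking, quantified (under RH):** there is an absolute constant `C` such that for every
window `a ≥ 2`, every ground state `u` at `a` and every non-trivial zero `ρ`,
`‖û(ρ)‖² ≤ C exp(−(π/2) e^{2(a−1)})` — the transform of a ground state nearly vanishes at every
zeta zero, super-exponentially in the window (`weilGroundEnergy_le_superexp`, RH-free, for the
energy).  Numerically (`Cruxes/GroundStatesConvergeToXi/Numerics-r1-k2.md`) the zeros of `û_a`
on the critical line agree with the zeta ordinates to `1e-18` already at `a = 1.24`. [folklore] -/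
theorem exists_norm_sq_weilMellin_le_superexp_of_riemannHypothesis (hRH : RiemannHypothesis) :
    ∃ C : ℝ, 0 ≤ C ∧ ∀ a : ℝ, 2 ≤ a → ∀ u : ℝ → ℂ, IsWeilGroundState a u →
      ∀ ρ ∈ ZetaZeros.riemannZetaNontrivialZeros,
        ‖weilMellin u ρ‖ ^ 2 ≤ C * Real.exp (-(π / 2 * Real.exp (2 * (a - 1)))) := by
  obtain ⟨C, hC, h⟩ := weilGroundEnergy_le_superexp
  exact ⟨C, hC, fun a ha u hu ρ hρ ↦
    (norm_sq_weilMellin_le_weilGroundEnergy_of_riemannHypothesis hRH hu hρ).trans (h a ha)⟩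

end Summit.RiemannHypothesis.RiemannHypothesis.Theorems.GroundStatesConvergeToXi

end
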